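import Summits.MatrixMultiplication.MatrixMultiplication.Theorems.ObstructionCalculusLocality
import Summits.MatrixMultiplication.MatrixMultiplication.Theorems.ObstructionDescentTorusLaws
import Summits.MatrixMultiplication.MatrixMultiplication.Theses.ObstructionDescent

set_option linter.dupNamespace false

/-!
# Corner equations: `E ⟺ E_corner ⟺ E_corner for isobaric equations` (decomp-mm · lens 3 · gens 8–9 kernel, landed gen 11)

Route `route-MatrixMultiplication-ObstructionDescent` (sub-problem `MatrixMultiplication`, `ω(ℂ) = 2`).  This module closes the
aside **`IsobaricCornerEquationsSuffice`** (item `stmt-MatrixMultiplication-31756`) BY NAME.  It imports the LANDED obstruction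
calculus (`fromCols`, `actTensor_unitTensor`, `padIdx`, `padMM`, `padTensor`, `evalT`, `orbitVanishing`,
`evalT_eq_zero_of_tensorRank_le`) and the torus laws (`RV`, `wt`, `isoComp`, `aeval_eq_zero_of_isobaric`,
`aeval_indicator_eq_sum_coeff_large`), and proves:

* §1 the CORNER TRANSFER of the degree axis `E = NoPolyDegreeObstruction`, cell by cell and as an equivalence
  (`noPolyDegreeObstruction_iff_corner`): at the quadratic scale, «no equation of `σ_m(ℂ^m ⊗ ℂ^m ⊗ ℂ^m)` of degree `≤ m^c`
  separates `pad_m⟨n,n,n⟩` from `GL_m³·⟨m⟩`» iff «no equation of `σ_m((ℂ^{n×n})^{⊗3})` of degree `≤ m^c` is non-zero AT the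
  fixed tensor `⟨n,n,n⟩`» — pull back along the corner embedding one way (`rename_cornerEmb_mem_orbitVanishing`), along the
  degree-preserving linear substitution `t ↦ (A,B,C)·pad_m(t)` the other way (`aeval_bind₁_actPadForm`);
* §2 the ISOBARIC NORMAL FORM: by the torus-weight law it suffices to test isobaric corner equations (weight vectors of the
  maximal torus of `GL_{n²}^{×3}`), whose value at `⟨n,n,n⟩` is a plain signed coefficient sum over 3-way tables
  (`aeval_matMul_eq_sum_coeff`); hence `isobaricCornerEquationsSuffice_holds`.

No proposition is defined; sorry-free; standard axioms.  Source: kernels `DegreeFiltration_g8_tree.lean` (Corner transfer) and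
`EquationNormalForm_g9_tree.lean` Part 6 §6.4 (bodies byte-identical up to the cell-wise packaging).
[cite: LandsbergGCT2017, §7.1 (p. 218), §8.3.2 (p. 226), §8.3.4 (p. 227); Blaser2013, Lemma 5.4, §5; BurgisserIkenmeyer2011, §2 (2.2), §3.1]
-/

noncomputable section

open scoped BigOperators
open Finset

namespace Summit.MatrixMultiplication.MatrixMultiplication.Theorems.ObstructionDescentCornerEquations

open Literature.Computability.AlgebraicComplexity (triad tensorRank matMulTensor unitTensor actTensor actTensor_one
  actTensor_apply tensorRestrictsTo_precomp tensorRestrictsTo_actTensor tensorRank_le_card_of_eq_sum)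
open Summit.MatrixMultiplication.MatrixMultiplication.Theorems.ObstructionCalculus
open Summit.MatrixMultiplication.MatrixMultiplication.Theorems.ObstructionDescentTorusLaws
open Summit.MatrixMultiplication.MatrixMultiplication.Theses.ObstructionDescent

/-! ## §1 The corner format and the corner transfer of `E` -/

section Corner

/-- Index type of the corner format `(ℂ^{n×n})^{⊗3}`. [bookkeeping] -/
abbrev CIdx (n : ℕ) : Type := (Fin n × Fin n) × (Fin n × Fin n) × (Fin n × Fin n)

/-- Equations «of border-rank type» in the corner format: polynomials on `(ℂ^{n×n})^{⊗3}` vanishing at every tensor of rank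
`≤ m` (for `n² < m` below the generic rank, the equations of the proper subvariety `σ_m((ℂ^{n²})^{⊗3})`).
[cite: LandsbergGCT2017, §8.3.2 (p. 226)] -/
def rankVanishing (n m : ℕ) : Set (MvPolynomial (CIdx n) ℂ) :=
  {h | ∀ t : (Fin n × Fin n) → (Fin n × Fin n) → (Fin n × Fin n) → ℂ, tensorRank t ≤ m →
      MvPolynomial.aeval (fun p : CIdx n => t p.1 p.2.1 p.2.2) h = 0}

variable {n m : ℕ}

/-- Membership in `rankVanishing`, unfolded. [bookkeeping] -/
theorem mem_rankVanishing {h : MvPolynomial (CIdx n) ℂ} : h ∈ rankVanishing n m ↔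
    ∀ t : (Fin n × Fin n) → (Fin n × Fin n) → (Fin n × Fin n) → ℂ, tensorRank t ≤ m →
      MvPolynomial.aeval (fun p : CIdx n => t p.1 p.2.1 p.2.2) h = 0 := Iff.rfl

/-- The corner equations are the torus-laws set `RV` of the format `α = β = γ = Fin n × Fin n`. [bookkeeping] -/
theorem rankVanishing_eq_RV (n m : ℕ) :
    rankVanishing n m = RV (Fin n × Fin n) (Fin n × Fin n) (Fin n × Fin n) m := rfl

/-- Structured reading of the route item `E = NoPolyDegreeObstruction` over the landed calculus. [bookkeeping] -/
theorem noPolyDegreeObstruction_iff : NoPolyDegreeObstruction ↔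
    ∀ c : ℕ, ∀ τ : ℝ, 2 < τ → ∃ n₀ : ℕ, ∀ n m : ℕ, n₀ ≤ n → ∀ h : n * n ≤ m, (n : ℝ) ^ τ ≤ (m : ℝ) →
      ∀ f : MvPolynomial (Idx m) ℂ, f.totalDegree ≤ m ^ c →
        f ∈ orbitVanishing (unitTensor ℂ m) → f ∈ orbitVanishing (padMM ℂ n m h) :=
  Iff.rfl

/-- `pad_m⟨n,n,n⟩` restricted to the embedded indices is `⟨n,n,n⟩`. [bookkeeping] -/
theorem padMM_padIdx (h : n * n ≤ m) (i j l : Fin n × Fin n) :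
    padMM ℂ n m h (padIdx n m h i) (padIdx n m h j) (padIdx n m h l) = matMulTensor ℂ n n n i j l := by
  have hinj : Function.Injective (padIdx n m h) := fun x y hxy =>
    finProdFinEquiv.injective (Fin.castLE_injective h hxy)
  unfold padMM padTensor
  rw [Finset.sum_eq_single (i, j, l)]
  · simp
  · rintro ⟨i', j', l'⟩ _ hne
    have : ¬ (padIdx n m h i' = padIdx n m h i ∧ padIdx n m h j' = padIdx n m h j ∧
        padIdx n m h l' = padIdx n m h l) := by
      rintro ⟨h1, h2, h3⟩
      exact hne (by rw [hinj h1, hinj h2, hinj h3])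
    rw [if_neg this, zero_mul]
  · intro hmem
    exact absurd (Finset.mem_univ _) hmem

/-- The corner embedding of coordinates `(ℂ^{n×n})^{⊗3} ↪ (ℂ^m)^{⊗3}`, on indices. [bookkeeping] -/
def cornerEmb (h : n * n ≤ m) : CIdx n → Idx m :=
  fun p => (padIdx n m h p.1, padIdx n m h p.2.1, padIdx n m h p.2.2)

/-- `R([A|B|C]) ≤ m`. [cite: BurgisserIkenmeyer2011, §2 (2.2)] -/
theorem tensorRank_fromCols_le (A B C : Matrix (Fin m) (Fin m) ℂ) : tensorRank (fromCols A B C) ≤ m := by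
  have := tensorRank_le_card_of_eq_sum
    (t := fromCols A B C) (σ := Fin m) (fun l a => A a l) (fun l b => B b l) (fun l c => C c l) rfl
  simpa using this

/-- Pull-back of a corner equation along the embedding is an equation of `σ_m` in the big format: at `(A,B,C)·⟨m⟩ = [A|B|C]`
it evaluates the corner equation at the corner restriction of `[A|B|C]`, a tensor of rank `≤ m` (restriction is
rank-monotone). [cite: Blaser2013, Lemma 5.4] -/
theorem rename_cornerEmb_mem_orbitVanishing (hnm : n * n ≤ m) {h : MvPolynomial (CIdx n) ℂ}
    (hh : h ∈ rankVanishing n m) :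
    MvPolynomial.rename (cornerEmb hnm) h ∈ orbitVanishing (unitTensor ℂ m) := by
  refine mem_orbitVanishing.2 fun A B C _ _ _ => ?_
  have hT : tensorRank (fun a b c : Fin n × Fin n =>
      fromCols A B C (padIdx n m hnm a) (padIdx n m hnm b) (padIdx n m hnm c)) ≤ m :=
    (tensorRestrictsTo_precomp (fromCols A B C) (padIdx n m hnm) (padIdx n m hnm)
      (padIdx n m hnm)).tensorRank_le.trans (tensorRank_fromCols_le A B C)
  have hfun : (fun q : Idx m => fromCols A B C q.1 q.2.1 q.2.2) ∘ cornerEmb hnm =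
      fun p : CIdx n => fromCols A B C (padIdx n m hnm p.1) (padIdx n m hnm p.2.1) (padIdx n m hnm p.2.2) :=
    rfl
  unfold evalT
  rw [actTensor_unitTensor, MvPolynomial.aeval_rename, hfun]
  exact mem_rankVanishing.1 hh
    (fun a b c => fromCols A B C (padIdx n m hnm a) (padIdx n m hnm b) (padIdx n m hnm c)) hT

/-- Degree is preserved by the pull-back. [bookkeeping] -/
theorem totalDegree_rename_cornerEmb_le (hnm : n * n ≤ m) (h : MvPolynomial (CIdx n) ℂ) :
    (MvPolynomial.rename (cornerEmb hnm) h).totalDegree ≤ h.totalDegree :=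
  MvPolynomial.totalDegree_rename_le _ _

/-- **`E ⟹ E_corner` at a cell** `(n, m, D)`: if every equation of `σ_m(ℂ^{m³})` of degree `≤ D` seen by `GL_m³·⟨m⟩` is seen by
`pad_m⟨n,n,n⟩`, then every corner equation of `σ_m((ℂ^{n²})^{⊗3})` of degree `≤ D` vanishes AT `⟨n,n,n⟩`.  Contrapositive = the
refutation rule of the instrument «least degree of a corner equation non-zero at `⟨n,n,n⟩`». -/
theorem cornerCell_of_formatCell (hnm : n * n ≤ m) {D : ℕ}
    (H : ∀ f : MvPolynomial (Idx m) ℂ, f.totalDegree ≤ D →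
      f ∈ orbitVanishing (unitTensor ℂ m) → f ∈ orbitVanishing (padMM ℂ n m hnm))
    {h : MvPolynomial (CIdx n) ℂ} (hdeg : h.totalDegree ≤ D) (hh : h ∈ rankVanishing n m) :
    MvPolynomial.aeval (fun p : CIdx n => matMulTensor ℂ n n n p.1 p.2.1 p.2.2) h = 0 := by
  have hf := H (MvPolynomial.rename (cornerEmb hnm) h)
    ((totalDegree_rename_cornerEmb_le hnm h).trans hdeg) (rename_cornerEmb_mem_orbitVanishing hnm hh)
  have hdet : (1 : Matrix (Fin m) (Fin m) ℂ).det ≠ 0 := by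
    rw [Matrix.det_one]; exact one_ne_zero
  have h1 : evalT (actTensor 1 1 1 (padMM ℂ n m hnm)) (MvPolynomial.rename (cornerEmb hnm) h) = 0 :=
    mem_orbitVanishing.1 hf 1 1 1 hdet hdet hdet
  have hfun : (fun q : Idx m => padMM ℂ n m hnm q.1 q.2.1 q.2.2) ∘ cornerEmb hnm =
      fun p : CIdx n => matMulTensor ℂ n n n p.1 p.2.1 p.2.2 := by
    funext p
    exact padMM_padIdx hnm p.1 p.2.1 p.2.2
  unfold evalT at h1
  rw [actTensor_one, MvPolynomial.aeval_rename, hfun] at h1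
  exact h1

/-! ### The converse `E_corner ⟹ E`: linear pull-back of big-format equations to the corner -/

/-- Total degree does not increase under substitution of each variable by a polynomial of degree `≤ 1`. [bookkeeping] -/
theorem totalDegree_bind₁_le_of_le_one {σ τ : Type*} (φ : σ → MvPolynomial τ ℂ)
    (hφ : ∀ i, (φ i).totalDegree ≤ 1) (f : MvPolynomial σ ℂ) :
    (MvPolynomial.bind₁ φ f).totalDegree ≤ f.totalDegree := by
  classical
  conv_lhs => rw [f.as_sum]
  rw [map_sum]
  refine (MvPolynomial.totalDegree_finsetSum _ _).trans (Finset.sup_le fun d hd => ?_)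
  rw [MvPolynomial.bind₁_monomial]
  refine (MvPolynomial.totalDegree_mul _ _).trans ?_
  rw [MvPolynomial.totalDegree_C, zero_add]
  refine (MvPolynomial.totalDegree_finsetProd _ _).trans ?_
  calc ∑ i ∈ d.support, (φ i ^ d i).totalDegree
      ≤ ∑ i ∈ d.support, d i := Finset.sum_le_sum fun i _ =>
          (MvPolynomial.totalDegree_pow _ _).trans (by simpa using Nat.mul_le_mul_left (d i) (hφ i))
    _ = d.sum (fun _ e => e) := rfl
    _ ≤ f.totalDegree := MvPolynomial.le_totalDegree hd

/-- The linear forms `t ↦ ((A,B,C)·pad(t))_q` on the corner, as degree-1 polynomials. [bookkeeping] -/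
def actPadForm (hnm : n * n ≤ m) (A B C : Matrix (Fin m) (Fin m) ℂ) (q : Idx m) : MvPolynomial (CIdx n) ℂ :=
  ∑ p : CIdx n, MvPolynomial.C (A q.1 (padIdx n m hnm p.1) * B q.2.1 (padIdx n m hnm p.2.1) *
    C q.2.2 (padIdx n m hnm p.2.2)) * MvPolynomial.X p

/-- The forms `actPadForm` have degree `≤ 1`. [bookkeeping] -/
theorem totalDegree_actPadForm_le (hnm : n * n ≤ m) (A B C : Matrix (Fin m) (Fin m) ℂ) (q : Idx m) :
    (actPadForm hnm A B C q).totalDegree ≤ 1 := by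
  classical
  unfold actPadForm
  refine (MvPolynomial.totalDegree_finsetSum _ _).trans (Finset.sup_le fun p _ => ?_)
  refine (MvPolynomial.totalDegree_mul _ _).trans ?_
  rw [MvPolynomial.totalDegree_C, zero_add]
  exact (MvPolynomial.totalDegree_X (R := ℂ) p).le

/-- Zero-padding is the action of the `0/1` embedding matrices, hence rank-monotone. [bookkeeping] -/
theorem padTensor_eq_actTensor {ι : Type} [Fintype ι] [DecidableEq ι] (e : ι → Fin m) (t : ι → ι → ι → ℂ) :
    padTensor e t = actTensor (fun a i => if e i = a then (1 : ℂ) else 0) (fun b j => if e j = b then (1 : ℂ) else 0)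
      (fun c l => if e l = c then (1 : ℂ) else 0) t := by
  funext a b c
  rw [actTensor_apply]
  unfold padTensor
  rw [Fintype.sum_prod_type]
  refine Finset.sum_congr rfl fun i _ => ?_
  rw [Fintype.sum_prod_type]
  refine Finset.sum_congr rfl fun j _ => Finset.sum_congr rfl fun l _ => ?_
  by_cases h1 : e i = a <;> by_cases h2 : e j = b <;> by_cases h3 : e l = c <;> simp [h1, h2, h3]

/-- Zero-padding does not raise the rank. [cite: Blaser2013, Lemma 5.4] -/
theorem tensorRank_padTensor_le {ι : Type} [Fintype ι] [DecidableEq ι] (e : ι → Fin m) (t : ι → ι → ι → ℂ) :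
    tensorRank (padTensor e t) ≤ tensorRank t := by
  rw [padTensor_eq_actTensor]
  exact (tensorRestrictsTo_actTensor _ _ _ t).tensorRank_le

/-- Entries of `(A,B,C)·pad_m(t)` are the linear forms `actPadForm` evaluated at `t`. [bookkeeping] -/
theorem actTensor_padTensor_apply (hnm : n * n ≤ m) (A B C : Matrix (Fin m) (Fin m) ℂ)
    (t : (Fin n × Fin n) → (Fin n × Fin n) → (Fin n × Fin n) → ℂ) (q : Idx m) :
    actTensor A B C (padTensor (padIdx n m hnm) t) q.1 q.2.1 q.2.2 =
      ∑ p : CIdx n, A q.1 (padIdx n m hnm p.1) * B q.2.1 (padIdx n m hnm p.2.1) *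
        C q.2.2 (padIdx n m hnm p.2.2) * t p.1 p.2.1 p.2.2 := by
  classical
  set e := padIdx n m hnm with he
  rw [actTensor_apply]
  have htriple : (∑ a', ∑ b', ∑ c', A q.1 a' * B q.2.1 b' * C q.2.2 c' * padTensor e t a' b' c') =
      ∑ x : Idx m, A q.1 x.1 * B q.2.1 x.2.1 * C q.2.2 x.2.2 * padTensor e t x.1 x.2.1 x.2.2 := by
    symm
    rw [Fintype.sum_prod_type]
    refine Finset.sum_congr rfl fun a' _ => ?_
    rw [Fintype.sum_prod_type]
  rw [htriple]
  unfold padTensor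
  simp_rw [Finset.mul_sum]
  rw [Finset.sum_comm]
  refine Finset.sum_congr rfl fun p _ => ?_
  rw [Finset.sum_eq_single (e p.1, e p.2.1, e p.2.2)]
  · simp
  · intro x _ hx
    have hne : ¬ (e p.1 = x.1 ∧ e p.2.1 = x.2.1 ∧ e p.2.2 = x.2.2) := by
      rintro ⟨h1, h2, h3⟩
      exact hx (Prod.ext h1.symm (Prod.ext h2.symm h3.symm))
    simp [hne]
  · intro h
    exact absurd (Finset.mem_univ _) h

/-- Evaluating the pulled-back polynomial at `t` = evaluating `f` at `(A,B,C)·pad(t)`. [bookkeeping] -/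
theorem aeval_bind₁_actPadForm (hnm : n * n ≤ m) (A B C : Matrix (Fin m) (Fin m) ℂ)
    (t : (Fin n × Fin n) → (Fin n × Fin n) → (Fin n × Fin n) → ℂ) (f : MvPolynomial (Idx m) ℂ) :
    MvPolynomial.aeval (fun p : CIdx n => t p.1 p.2.1 p.2.2) (MvPolynomial.bind₁ (actPadForm hnm A B C) f) =
      evalT (actTensor A B C (padTensor (padIdx n m hnm) t)) f := by
  unfold evalT
  rw [MvPolynomial.aeval_bind₁]
  have hfun : (fun q : Idx m => MvPolynomial.aeval (fun p : CIdx n => t p.1 p.2.1 p.2.2) (actPadForm hnm A B C q)) =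
      fun q : Idx m => actTensor A B C (padTensor (padIdx n m hnm) t) q.1 q.2.1 q.2.2 := by
    funext q
    rw [actTensor_padTensor_apply]
    simp [actPadForm, map_sum]
  rw [hfun]

/-- **`E_corner ⟹ E` at a cell** `(n, m, D)`: pull an equation `f` of `σ_m(ℂ^{m³})` back along `t ↦ (A,B,C)·pad_m(t)` (a corner
polynomial of no larger degree, vanishing on rank `≤ m` corner tensors because `(A,B,C)·pad_m(·)` is rank-monotone) and evaluate
at `⟨n,n,n⟩`. -/
theorem formatCell_of_cornerCell (hnm : n * n ≤ m) {D : ℕ}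
    (H : ∀ h : MvPolynomial (CIdx n) ℂ, h.totalDegree ≤ D → h ∈ rankVanishing n m →
      MvPolynomial.aeval (fun p : CIdx n => matMulTensor ℂ n n n p.1 p.2.1 p.2.2) h = 0)
    {f : MvPolynomial (Idx m) ℂ} (hdeg : f.totalDegree ≤ D) (hf : f ∈ orbitVanishing (unitTensor ℂ m)) :
    f ∈ orbitVanishing (padMM ℂ n m hnm) := by
  refine mem_orbitVanishing.2 fun A B C _ _ _ => ?_
  have key := H (MvPolynomial.bind₁ (actPadForm hnm A B C) f)
    ((totalDegree_bind₁_le_of_le_one _ (totalDegree_actPadForm_le hnm A B C) f).trans hdeg) ?_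
  · rw [aeval_bind₁_actPadForm] at key
    exact key
  · refine mem_rankVanishing.2 fun t ht => ?_
    rw [aeval_bind₁_actPadForm]
    refine evalT_eq_zero_of_tensorRank_le hf ?_
    calc tensorRank (actTensor A B C (padTensor (padIdx n m hnm) t))
        ≤ tensorRank (padTensor (padIdx n m hnm) t) := (tensorRestrictsTo_actTensor A B C _).tensorRank_le
      _ ≤ tensorRank t := tensorRank_padTensor_le _ t
      _ ≤ m := ht

/-- **`E ⟺ E_corner`** (gen-8 hand theorem, kernel): the degree axis `NoPolyDegreeObstruction` read on the FIXED tensor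
`⟨n,n,n⟩ ∈ (ℂ^{n×n})^{⊗3}` — at the quadratic scale no corner equation of `σ_m` of degree `≤ m^c` is non-zero at `⟨n,n,n⟩`. -/
theorem noPolyDegreeObstruction_iff_corner : NoPolyDegreeObstruction ↔
    ∀ c : ℕ, ∀ τ : ℝ, 2 < τ → ∃ n₀ : ℕ, ∀ n m : ℕ, n₀ ≤ n → n * n ≤ m → (n : ℝ) ^ τ ≤ (m : ℝ) →
      ∀ h : MvPolynomial (CIdx n) ℂ, h.totalDegree ≤ m ^ c → h ∈ rankVanishing n m →
        MvPolynomial.aeval (fun p : CIdx n => matMulTensor ℂ n n n p.1 p.2.1 p.2.2) h = 0 := by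
  rw [noPolyDegreeObstruction_iff]
  constructor
  · intro hE c τ hτ
    obtain ⟨n₀, hn₀⟩ := hE c τ hτ
    exact ⟨n₀, fun n m hn hnm hτm h hdeg hh => cornerCell_of_formatCell hnm (hn₀ n m hn hnm hτm) hdeg hh⟩
  · intro hC c τ hτ
    obtain ⟨n₀, hn₀⟩ := hC c τ hτ
    exact ⟨n₀, fun n m hn hnm hτm f hdeg hf => formatCell_of_cornerCell hnm (hn₀ n m hn hnm hτm) hdeg hf⟩

end Corner

/-! ## §2 The isobaric normal form and the MM table formula -/

section Isobaric

variable {n m : ℕ}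

/-- The support of `⟨n,n,n⟩` in the corner format (the `n³` cells `((i,k),(i,j),(j,k))`), as a finset.
[cite: Blaser2013, §5 (the tensor ⟨k,m,n⟩)] -/
def mmCells (n : ℕ) : Finset (CIdx n) :=
  Finset.univ.filter fun p => p.1.1 = p.2.1.1 ∧ p.2.1.2 = p.2.2.1 ∧ p.1.2 = p.2.2.2

/-- `⟨n,n,n⟩` is the `0/1` indicator of `mmCells n`. [bookkeeping] -/
theorem matMulTensor_eq_indicator (n : ℕ) (p : CIdx n) :
    matMulTensor ℂ n n n p.1 p.2.1 p.2.2 = if p ∈ mmCells n then (1 : ℂ) else 0 := by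
  simp [mmCells, matMulTensor]

/-- **MM table formula**: a corner equation `h` of `σ_m` evaluates at `⟨n,n,n⟩` to the plain sum of the coefficients of its
monomials supported inside `supp⟨n,n,n⟩` (exponents = 3-way tables `e : [n]³ → ℕ`) and using MORE THAN `m` distinct cells. -/
theorem aeval_matMul_eq_sum_coeff {h : MvPolynomial (CIdx n) ℂ} (hh : h ∈ rankVanishing n m) :
    MvPolynomial.aeval (fun p : CIdx n => matMulTensor ℂ n n n p.1 p.2.1 p.2.2) h =
      ∑ μ ∈ h.support.filter (fun μ => μ.support ⊆ mmCells n ∧ m < μ.support.card), h.coeff μ := by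
  have hfun : (fun p : CIdx n => matMulTensor ℂ n n n p.1 p.2.1 p.2.2) =
      fun p : CIdx n => if p ∈ mmCells n then (1 : ℂ) else 0 :=
    funext (matMulTensor_eq_indicator n)
  have hh' : h ∈ RV (Fin n × Fin n) (Fin n × Fin n) (Fin n × Fin n) m := hh
  rw [hfun]
  exact aeval_indicator_eq_sum_coeff_large (mmCells n) hh'

/-- **L1 in the corner**: every monomial of a corner equation of `σ_m` uses more than `m` cells. -/
theorem lt_card_support_of_mem_rankVanishing {h : MvPolynomial (CIdx n) ℂ}
    (hh : h ∈ rankVanishing n m) {μ : CIdx n →₀ ℕ} (hμ : μ ∈ h.support) : m < μ.support.card :=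
  lt_card_support_of_mem_support (α := Fin n × Fin n) (β := Fin n × Fin n) (γ := Fin n × Fin n) hh hμ

/-- **L2 in the corner**: isobaric components of corner equations of `σ_m` are corner equations of `σ_m`. -/
theorem isoComp_mem_rankVanishing {h : MvPolynomial (CIdx n) ℂ}
    (hh : h ∈ rankVanishing n m) (w : WIdx (Fin n × Fin n) (Fin n × Fin n) (Fin n × Fin n) →₀ ℕ) :
    isoComp w h ∈ rankVanishing n m :=
  isoComp_mem_RV (α := Fin n × Fin n) (β := Fin n × Fin n) (γ := Fin n × Fin n) hh w

/-- **Isobaric reduction at a cell** `(n, m, D)`: if every ISOBARIC corner equation of `σ_m` of degree `≤ D` vanishes at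
`⟨n,n,n⟩`, then every corner equation of `σ_m` of degree `≤ D` does. -/
theorem cornerCell_of_isobaricCell {D : ℕ}
    (H : ∀ g : MvPolynomial (CIdx n) ℂ, (∃ w, ∀ μ ∈ g.support, wt μ = w) → g.totalDegree ≤ D →
      g ∈ rankVanishing n m → MvPolynomial.aeval (fun p : CIdx n => matMulTensor ℂ n n n p.1 p.2.1 p.2.2) g = 0)
    {h : MvPolynomial (CIdx n) ℂ} (hd : h.totalDegree ≤ D) (hh : h ∈ rankVanishing n m) :
    MvPolynomial.aeval (fun p : CIdx n => matMulTensor ℂ n n n p.1 p.2.1 p.2.2) h = 0 := by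
  have hh' : h ∈ RV (Fin n × Fin n) (Fin n × Fin n) (Fin n × Fin n) m := hh
  exact aeval_eq_zero_of_isobaric (m := m) (D := D) _ (fun g hg hgd hgm => H g hg hgd hgm) hd hh'

/-- **E-core at a cell, table normal form**: if at `(n, m)` every isobaric corner equation `g` of `σ_m` of degree `≤ D` has
vanishing table sum `Σ_{μ ∈ supp g, supp μ ⊆ mmCells n, |supp μ| > m} coeff_μ g = 0`, then every corner equation of `σ_m` of
degree `≤ D` vanishes at `⟨n,n,n⟩`. -/
theorem cornerCell_of_isobaric_tableSums {D : ℕ}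
    (H : ∀ g : MvPolynomial (CIdx n) ℂ, (∃ w, ∀ μ ∈ g.support, wt μ = w) → g.totalDegree ≤ D →
      g ∈ rankVanishing n m → ∑ μ ∈ g.support.filter (fun μ => μ.support ⊆ mmCells n ∧ m < μ.support.card), g.coeff μ = 0)
    {h : MvPolynomial (CIdx n) ℂ} (hd : h.totalDegree ≤ D) (hh : h ∈ rankVanishing n m) :
    MvPolynomial.aeval (fun p : CIdx n => matMulTensor ℂ n n n p.1 p.2.1 p.2.2) h = 0 := by
  refine cornerCell_of_isobaricCell (fun g hg hgd hgm => ?_) hd hh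
  rw [aeval_matMul_eq_sum_coeff hgm]
  exact H g hg hgd hgm

/-- **`E ⟺ E_corner for isobaric equations`** (gen-9 hand theorem, kernel): WLOG a polynomial-degree obstruction is a weight
vector of the maximal torus of `GL_{n²}^{×3}` («isobaric»: all monomials have the same three marginals `wt μ`). -/
theorem noPolyDegreeObstruction_iff_cornerIsobaric : NoPolyDegreeObstruction ↔
    ∀ c : ℕ, ∀ τ : ℝ, 2 < τ → ∃ n₀ : ℕ, ∀ n m : ℕ, n₀ ≤ n → n * n ≤ m → (n : ℝ) ^ τ ≤ (m : ℝ) →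
      ∀ h : MvPolynomial (CIdx n) ℂ, (∃ w, ∀ μ ∈ h.support, wt μ = w) → h.totalDegree ≤ m ^ c →
        h ∈ rankVanishing n m → MvPolynomial.aeval (fun p : CIdx n => matMulTensor ℂ n n n p.1 p.2.1 p.2.2) h = 0 := by
  rw [noPolyDegreeObstruction_iff_corner]
  constructor
  · intro hC c τ hτ
    obtain ⟨n₀, hn₀⟩ := hC c τ hτ
    exact ⟨n₀, fun n m hn hnm hτm h _ hd hh => hn₀ n m hn hnm hτm h hd hh⟩
  · intro hI c τ hτ
    obtain ⟨n₀, hn₀⟩ := hI c τ hτ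
    exact ⟨n₀, fun n m hn hnm hτm h hd hh =>
      cornerCell_of_isobaricCell (fun g hg hgd hgm => hn₀ n m hn hnm hτm g hg hgd hgm) hd hh⟩

end Isobaric

end Summit.MatrixMultiplication.MatrixMultiplication.Theorems.ObstructionDescentCornerEquations

/-! ## §3 The route item, by name -/

namespace Summit.MatrixMultiplication.MatrixMultiplication.Theses.ObstructionDescent

/-- **item `stmt-MatrixMultiplication-31756` `IsobaricCornerEquationsSuffice`** (aside, rank 9): `E = NoPolyDegreeObstruction`
holds iff, at the quadratic scale, every ISOBARIC equation of `σ_m((ℂ^{n×n})^{⊗3})` of degree `≤ m^c` vanishes at the fixed tensor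
`⟨n,n,n⟩`.  PROVED (the item text is `noPolyDegreeObstruction_iff_cornerIsobaric` with `wt`, `rankVanishing` unfolded).
[cite: LandsbergGCT2017, §7.1 (p. 218); BurgisserIkenmeyer2011, §3.1] -/
theorem isobaricCornerEquationsSuffice_holds : IsobaricCornerEquationsSuffice :=
  Theorems.ObstructionDescentCornerEquations.noPolyDegreeObstruction_iff_cornerIsobaric

end Summit.MatrixMultiplication.MatrixMultiplication.Theses.ObstructionDescent

end
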